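import Literature.AlgebraicTopology.Homotopy.WangSequence
import Literature.AlgebraicTopology.SingularHomology.CupProductProofs
import HarnessLib

/-!
# The Wang derivation is a derivation: `D(y ⌣ z) = D y ⌣ z ± y ⌣ D z`

G. W. Whitehead, *Elements of Homotopy Theory* (1978), Ch. VII §7, Thm. 7.14 (3): for a fibration
`F → E → Sᵐ` the map `θ : Hⁿ(F) → Hⁿ⁻ᵐ⁺¹(F)` of the Wang sequence "is a derivation:
`θ(x ⌣ y) = θx ⌣ y + (-1)^{(m-1) |x|} x ⌣ θy`" (H. C. Wang, Duke Math. J. 16 (1949), Thm. on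
p. 37). The tree's `WangSequence.lean` constructs `D = θ` (`Wang.D`) for a Hurewicz/Serre fibration
`p : E → 𝕊ᵏ⁺²` as the `Hⁱ(F)`-component of the multiplicative clutching map `T`
(`T y = pr₁^* y + pr₂^* g ⌣ pr₁^*(D y)`, `Wang.T_eq_sphereSplit`, `Wang.T_cupProduct`) and proves
the mixed-degree case `Wang.D_cupProduct_of_lt` (one factor of degree `< k + 1`). This file PROVES
the remaining case of Whitehead's (3), both factors of degree `≥ k + 1` (no definitions):

* `Wang.D_cupProduct` — for `y ∈ H^{i+(k+1)}(F)`, `z ∈ H^{j+(k+1)}(F)`: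
  `D (y ⌣ z) = D y ⌣ z + (-1)^{(i+(k+1))(k+1)} • y ⌣ D z` in `H^{(i+(k+1))+j}(F)`.

Proof (Whitehead's): expand `T(y ⌣ z) = T y ⌣ T z` bilinearly; `pr₁^* y ⌣ pr₁^* z = pr₁^*(y ⌣ z)`;
the two mixed terms are `pr₂^* g ⌣ pr₁^*(D y ⌣ z)` and, after moving `pr₂^* g` past `pr₁^* y`
(graded commutativity, sign `(-1)^{(i+k+1)(k+1)}`), `pr₂^* g ⌣ pr₁^*(y ⌣ D z)`; the last term
contains `g ⌣ g = 0` (`Wang.cupProduct_gen_gen`); uniqueness of the decomposition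
(`Wang.eq_D_of_T_eq`) then reads off `D(y ⌣ z)`.

## References

* G. W. Whitehead, *Elements of Homotopy Theory*, GTM 61, Springer (1978), Ch. VII §7,
  Thm. 7.14 (3). [Whitehead1978]
* H. C. Wang, *The homology groups of the fibre bundles over a sphere*, Duke Math. J. 16 (1949),
  33–38. [Wang1949]
-/

noncomputable section

open Set Function Metric unitInterval CategoryTheory
open scoped Topology unitInterval
open Literature.AlgebraicTopology.SingularHomology

namespace Literature.AlgebraicTopology.Homotopy

namespace Wang

variable (R : Type) [CommRing R] {E : Type} [TopologicalSpace E] {k : ℕ} (P : Poles k)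
  {p : E → (Metric.sphere (0 : EuclideanSpace ℝ (Fin (k + 2 + 1))) 1)}

/-! ### The Leibniz rule -/

set_option maxHeartbeats 1000000 in
/-- **The Wang derivation is a derivation** (Whitehead 1978, VII.7.14 (3); Wang 1949): for
`y ∈ H^{i+(k+1)}(F)` and `z ∈ H^{j+(k+1)}(F)`,
`D (y ⌣ z) = D y ⌣ z + (-1)^{(i+(k+1))(k+1)} • (y ⌣ D z)` in degree `(i+(k+1)) + j`.
[cite: Whitehead1978, Ch. VII §7, Thm. 7.14 (3)] [cite: Wang1949, p. 37] -/
theorem D_cupProduct (hp : IsHurewiczFibration.{0, 0, 0} p) (hpS : IsSerreFibration p) {i j : ℕ}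
    (y : singularCohomology R R (Fib P p) (i + (k + 1)))
    (z : singularCohomology R R (Fib P p) (j + (k + 1))) :
    D R P hp hpS ((i + (k + 1)) + j)
        (cupProduct (show (i + (k + 1)) + (j + (k + 1)) = ((i + (k + 1)) + j) + (k + 1) by omega) y z) =
      cupProduct (show i + (j + (k + 1)) = (i + (k + 1)) + j by omega) (D R P hp hpS i y) z +
        ((-1 : R) ^ ((i + (k + 1)) * (k + 1))) • cupProduct rfl y (D R P hp hpS j z) := by
  symm
  refine (eq_D_of_T_eq R P hp hpS ((i + (k + 1)) + j) _
    (cupProduct (show (i + (k + 1)) + (j + (k + 1)) = ((i + (k + 1)) + j) + (k + 1) by omega) y z) _ ?_).2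
  -- notation for the pieces
  set F := Fib P p
  set fst' : C(F × ↥P.bandSet, F) := ContinuousMap.fst with hfst'
  set snd' : C(F × ↥P.bandSet, ↥P.bandSet) := ContinuousMap.snd with hsnd'
  set G : singularCohomology R R (F × ↥P.bandSet) (k + 1) := singularCohomology.map R R snd' (k + 1) (P.gen R) with hG
  set Y := singularCohomology.map R R fst' (i + (k + 1)) y with hY
  set Zc := singularCohomology.map R R fst' (j + (k + 1)) z with hZc
  set DY := singularCohomology.map R R fst' i (D R P hp hpS i y) with hDY
  set DZ := singularCohomology.map R R fst' j (D R P hp hpS j z) with hDZ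
  have hGG : ∀ (h : (k + 1) + (k + 1) = (k + 1) + (k + 1)), cupProduct h G G = 0 := fun h => by
    rw [hG, ← cupProduct_map, cupProduct_gen_gen, map_zero]
  -- expand `T (y ⌣ z) = T y ⌣ T z`
  rw [T_cupProduct, T_eq_sphereSplit, T_eq_sphereSplit, sphereSplit_apply, sphereSplit_apply,
    sphereSplit_apply]
  rw [map_add (cupProduct _), LinearMap.add_apply, map_add, map_add]
  -- name the four terms
  rw [← hfst', ← hsnd', ← hG, ← hY, ← hZc, ← hDY, ← hDZ]
  -- (a) `pr₁^* y ⌣ pr₁^* z = pr₁^* (y ⌣ z)`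
  have ha : cupProduct (show (i + (k + 1)) + (j + (k + 1)) = ((i + (k + 1)) + j) + (k + 1) by omega) Y Zc =
      singularCohomology.map R R fst' (((i + (k + 1)) + j) + (k + 1))
        (cupProduct (show (i + (k + 1)) + (j + (k + 1)) = ((i + (k + 1)) + j) + (k + 1) by omega) y z) := by
    rw [hY, hZc, cupProduct_map]
  -- (c) `(G ⌣ pr₁^* Dy) ⌣ pr₁^* z = G ⌣ pr₁^*(Dy ⌣ z)`
  have hc : cupProduct (show (i + (k + 1)) + (j + (k + 1)) = ((i + (k + 1)) + j) + (k + 1) by omega)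
      (cupProduct (Nat.add_comm (k + 1) i) G DY) Zc =
      cupProduct (Nat.add_comm (k + 1) ((i + (k + 1)) + j)) G
        (singularCohomology.map R R fst' ((i + (k + 1)) + j)
          (cupProduct (show i + (j + (k + 1)) = (i + (k + 1)) + j by omega) (D R P hp hpS i y) z)) := by
    rw [cupProduct_map, ← hDY, ← hZc]
    exact cupProduct_assoc (Nat.add_comm (k + 1) i) (show i + (j + (k + 1)) = (i + (k + 1)) + j by omega)
      _ _ G DY Zc
  -- (b) `pr₁^* y ⌣ (G ⌣ pr₁^* Dz) = ± G ⌣ pr₁^*(y ⌣ Dz)`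
  have hb : cupProduct (show (i + (k + 1)) + (j + (k + 1)) = ((i + (k + 1)) + j) + (k + 1) by omega)
      Y (cupProduct (Nat.add_comm (k + 1) j) G DZ) =
      ((-1 : R) ^ ((i + (k + 1)) * (k + 1))) • cupProduct (Nat.add_comm (k + 1) ((i + (k + 1)) + j)) G
        (singularCohomology.map R R fst' ((i + (k + 1)) + j) (cupProduct rfl y (D R P hp hpS j z))) := by
    -- reassociate: `Y ⌣ (G ⌣ DZ) = (Y ⌣ G) ⌣ DZ`
    rw [← cupProduct_assoc (rfl : (i + (k + 1)) + (k + 1) = (i + (k + 1)) + (k + 1)) (Nat.add_comm (k + 1) j)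
      (show ((i + (k + 1)) + (k + 1)) + j = ((i + (k + 1)) + j) + (k + 1) by omega)
      (show (i + (k + 1)) + (j + (k + 1)) = ((i + (k + 1)) + j) + (k + 1) by omega) Y G DZ]
    -- commute `Y ⌣ G = ± G ⌣ Y`
    rw [cupProduct_gradedComm_holds R (F × ↥P.bandSet) (rfl : (i + (k + 1)) + (k + 1) = (i + (k + 1)) + (k + 1))
      (Nat.add_comm (k + 1) (i + (k + 1))) Y G]
    rw [map_smul, LinearMap.smul_apply]
    congr 1
    -- reassociate back: `(G ⌣ Y) ⌣ DZ = G ⌣ (Y ⌣ DZ)` and pull `fst^*` out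
    rw [cupProduct_map, ← hY, ← hDZ]
    exact cupProduct_assoc (Nat.add_comm (k + 1) (i + (k + 1))) (rfl : (i + (k + 1)) + j = (i + (k + 1)) + j)
      _ _ G Y DZ
  -- (d) `(G ⌣ pr₁^* Dy) ⌣ (G ⌣ pr₁^* Dz) = 0`
  have hd : cupProduct (show (i + (k + 1)) + (j + (k + 1)) = ((i + (k + 1)) + j) + (k + 1) by omega)
      (cupProduct (Nat.add_comm (k + 1) i) G DY) (cupProduct (Nat.add_comm (k + 1) j) G DZ) = 0 := by
    -- `(G ⌣ DY) ⌣ (G ⌣ DZ) = G ⌣ (DY ⌣ (G ⌣ DZ))`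
    rw [cupProduct_assoc (Nat.add_comm (k + 1) i) (rfl : i + (j + (k + 1)) = i + (j + (k + 1)))
      (show (i + (k + 1)) + (j + (k + 1)) = ((i + (k + 1)) + j) + (k + 1) by omega)
      (show (k + 1) + (i + (j + (k + 1))) = ((i + (k + 1)) + j) + (k + 1) by omega) G DY _]
    -- `DY ⌣ (G ⌣ DZ) = (DY ⌣ G) ⌣ DZ = ± (G ⌣ DY) ⌣ DZ = ± G ⌣ (DY ⌣ DZ)`
    rw [← cupProduct_assoc (rfl : i + (k + 1) = i + (k + 1)) (Nat.add_comm (k + 1) j)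
      (show (i + (k + 1)) + j = i + (j + (k + 1)) by omega) (rfl : i + (j + (k + 1)) = i + (j + (k + 1))) DY G DZ]
    rw [cupProduct_gradedComm_holds R (F × ↥P.bandSet) (rfl : i + (k + 1) = i + (k + 1))
      (Nat.add_comm (k + 1) i) DY G, map_smul, LinearMap.smul_apply, map_smul]
    rw [cupProduct_assoc (Nat.add_comm (k + 1) i) (rfl : i + j = i + j)
      (show (i + (k + 1)) + j = i + (j + (k + 1)) by omega)
      (show (k + 1) + (i + j) = i + (j + (k + 1)) by omega) G DY DZ]
    -- `G ⌣ (G ⌣ (DY ⌣ DZ)) = (G ⌣ G) ⌣ (DY ⌣ DZ) = 0`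
    rw [← cupProduct_assoc (rfl : (k + 1) + (k + 1) = (k + 1) + (k + 1))
      (show (k + 1) + (i + j) = i + (j + (k + 1)) by omega)
      (show ((k + 1) + (k + 1)) + (i + j) = ((i + (k + 1)) + j) + (k + 1) by omega)
      (show (k + 1) + (i + (j + (k + 1))) = ((i + (k + 1)) + j) + (k + 1) by omega) G G _]
    rw [hGG, map_zero, LinearMap.zero_apply, smul_zero]
  simp only [ha, hb, hc, hd, add_zero]
  simp only [map_add, map_smul]
  abel

end Wang

end Literature.AlgebraicTopology.Homotopy

end
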